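import Summits.ValiantsHypothesis.ValiantsHypothesis.Theorems.BarrierLeverChowHitsPartitionMinorsRStarvedFacts

/-!
# Route BarrierLever — item `ChowHitsPartitionMinorsR` (stmt-ValiantsHypothesis-21882), STARVED DESIGN VIII:
# diagonal (pivot) entries, the small columns, and the SPAN TRANSFER from the row-reduced matrix to the `ρ̂`-matrix

Helper file (`--supports stmt-ValiantsHypothesis-21882`; cell valiant-natproofs, rung V4, 𝒟-side; prover seat val-np-p5
gen 31). Closes NO item. Eighth file of the kernel chain for THEOREM A′ of memo MEMO-21882-valnp5-g31.md §3/§5 (K-A3b-4(B)).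

* PIVOTS: `coeff_rr_self` (`coeff_{v} rr v = −1`), `coeff_rr_mul_rr_self` (an edge row at its own column: `1`),
  the non-edge pivot is `coeff_pNE_triple` (p725958) with `j' = j` (`24`);
* SMALL COLUMNS: non-edge rows vanish at `∅` and at O-singletons (`coeff_pNE_small`); `inc v {v} = 0` (`inc_self`);
* SPAN TRANSFER (`det_ne_zero_of_span`): if every row of a square matrix `P` is a linear combination of the rows of `N`
  and `det P ≠ 0` then `det N ≠ 0`; and the row-reduced polynomials ARE combinations of the normal-form rows:
  `rr_mem_span`, `rr_mul_rr_mem_span_of_col` (edge pairs), `pNE_mem_span` (matched non-edges; the `t_j²` terms cancel),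
  over `S = span {1, ρ̂₁ v, ρ̂₂ a b}`.

WHAT THIS IS NOT: the rank dispatch assembling THEOREM A′ is the sequel (`…RStarvedTheoremA`); nothing on crux
stmt-ValiantsHypothesis-14610 or on `VP` versus `VNP`.
-/

set_option linter.dupNamespace false

namespace Summit.ValiantsHypothesis.ValiantsHypothesis.Theorems.BarrierLever.ChowStarvedDesign

open Finset MvPolynomial

noncomputable section

variable {h r : ℕ}

/-! ## 1. A span-transfer criterion for determinants -/

/-- If `det P ≠ 0` and every row of `P` is a linear combination of the rows of `N` (as images of vectors `p i`, `n i` of a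
module under a common linear map), then `det N ≠ 0`. Concretely: rows given by a linear `Φ` applied to vectors. -/
theorem det_ne_zero_of_rows_mem_span {K V : Type*} [Field K] [AddCommGroup V] [Module K V] {r : ℕ}
    (Φ : V →ₗ[K] (Fin r → K)) (n p : Fin r → V)
    (hp : ∀ i, p i ∈ Submodule.span K (Set.range n))
    (hdet : (Matrix.of fun i j => Φ (p i) j).det ≠ 0) :
    (Matrix.of fun i j => Φ (n i) j).det ≠ 0 := by
  classical
  -- rows of `P` are combinations of rows of `N`: `P = E * N`
  have hcoef : ∀ i, ∃ c : Fin r → K, ∑ i', c i' • n i' = p i := fun i =>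
    (Submodule.mem_span_range_iff_exists_fun K).mp (hp i)
  choose c hc using hcoef
  have hPN : (Matrix.of fun i j => Φ (p i) j) = (Matrix.of fun i i' => c i i') * Matrix.of fun i j => Φ (n i) j := by
    ext i j
    rw [Matrix.mul_apply, Matrix.of_apply, ← hc i, map_sum]
    simp only [Matrix.of_apply, map_smul, Finset.sum_apply, Pi.smul_apply, smul_eq_mul]
  rw [hPN, Matrix.det_mul] at hdet
  exact right_ne_zero_of_mul hdet

/-! ## 2. Pivots and small columns of the starved design -/

section Starved

variable (w : Fin r → Finset (Fin h)) (O : Finset (Fin h)) (α β : {j : Fin r // (w j).card = 3} → Fin h)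
  (hα : ∀ j, α j ∈ O) (hβ : ∀ j, β j ∈ O) (hK : ∀ j : {j : Fin r // (w j).card = 3}, ∀ c ∈ w j.1, c ∉ O)

include hα hβ hK in
/-- No vertex is incident to itself: `inc v {v} = 0` (a matched vertex is in `O`, a 3-column avoids `O`). -/
theorem inc_self (v : Fin h) : inc w α β v {v} = 0 := by
  by_cases hv : v ∈ O
  · exact inc_eq_zero_of_mem w O α β hK hv (Finset.mem_singleton_self v) v
  · exact inc_eq_zero_of_not_mem w O α β hα hβ hv _

include hα hβ hK in
/-- **Singleton pivot**: `coeff (E ∅ {v}) (rr v) = −1`. -/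
theorem coeff_rr_self (v : Fin h) :
    coeff (∑ a' ∈ (∅ : Finset (Fin h)), Finsupp.single (Fin.castAdd h a') 1 +
        ∑ c ∈ ({v} : Finset (Fin h)), Finsupp.single (Fin.natAdd h c) 1) (rr w α β v) = -1 := by
  rw [coeff_rr_single, if_pos rfl, inc_self w O α β hα hβ hK v]
  norm_num

include hα hβ hK in
/-- **Edge pivot**: `coeff (E ∅ {x,y}) (rr x · rr y) = 1` (`x ≠ y`). -/
theorem coeff_rr_mul_rr_self (x y : Fin h) (hxy : x ≠ y) :
    coeff (∑ a' ∈ (∅ : Finset (Fin h)), Finsupp.single (Fin.castAdd h a') 1 +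
        ∑ c ∈ ({x, y} : Finset (Fin h)), Finsupp.single (Fin.natAdd h c) 1) (rr w α β x * rr w α β y) = 1 := by
  rw [coeff_rr_mul_rr_two w α β x y {x, y} (Finset.card_pair hxy), Finset.sum_pair hxy,
    Finset.erase_insert (Finset.notMem_singleton.mpr hxy), Finset.erase_insert_of_ne hxy, Finset.erase_singleton,
    Finset.insert_empty, inc_self w O α β hα hβ hK x, inc_self w O α β hα hβ hK y,
    if_neg (fun e => hxy (Finset.singleton_inj.mp e).symm), if_neg hxy, if_pos rfl, if_pos rfl]
  -- the cross term `inc x {y} · inc y {x}` vanishes: both nonzero would force `x ∉ O` and `x ∈ O`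
  have hcross : (inc w α β x {y} : ℂ) * (inc w α β y {x} : ℂ) = 0 := by
    by_cases hx : x ∈ O
    · rw [inc_eq_zero_of_mem w O α β hK hx (Finset.mem_singleton_self x) y]; simp
    · rw [inc_eq_zero_of_not_mem w O α β hα hβ hx]; simp
  linear_combination hcross

include hK in
/-- **Non-edge rows vanish at small columns inside `O`** (`W = ∅` or `W = {c}` with `c ∈ O`). -/
theorem coeff_pNE_small (j : {j : Fin r // (w j).card = 3}) (W : Finset (Fin h)) (hW : W.card ≤ 1)
    (hWO : ∀ c ∈ W, c ∈ O) :
    coeff (∑ c ∈ (∅ : Finset (Fin h)), Finsupp.single (Fin.castAdd h c) 1 +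
        ∑ c ∈ W, Finsupp.single (Fin.natAdd h c) 1) (rr w α β (α j) * rr w α β (β j) + corrNE w α β j) = 0 := by
  unfold corrNE
  rw [coeff_add, coeff_sub, coeff_sub, coeff_pivotTerm w j W (by omega), coeff_sum, coeff_sum,
    coeff_rr_mul_rr_le_one w α β _ _ W hW]
  simp_rw [coeff_C_mul, coeff_rr_mul_rr_le_one w α β _ _ W hW]
  have hpiv : (if W = ∅ then (0 : ℂ) else
      (if W.card = 1 then (2 : ℂ) else if W.card = 2 then -6 else 24) * (if W ⊆ w j.1 then 1 else 0)) = 0 := by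
    by_cases hW0 : W = ∅
    · rw [if_pos hW0]
    · obtain ⟨c, hc⟩ := Finset.nonempty_iff_ne_empty.mpr hW0
      have hsub : ¬ W ⊆ w j.1 := fun hsub => hK j c (hsub hc) (hWO c hc)
      rw [if_neg hW0, if_neg hsub, mul_zero]
  rw [hpiv]
  simp

end Starved

/-! ## 3. The row-reduced polynomials lie in the span of the normal-form rows -/

section Span

variable (w : Fin r → Finset (Fin h)) (O : Finset (Fin h)) (α β : {j : Fin r // (w j).card = 3} → Fin h)
  (hα : ∀ j, α j ∈ O) (hβ : ∀ j, β j ∈ O) (hK : ∀ j : {j : Fin r // (w j).card = 3}, ∀ c ∈ w j.1, c ∉ O)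

/-- The span of the normal-form rows `1`, `ρ̂₁ v`, `ρ̂₂ a b` (`a ≠ b`). -/
def rowSpan : Submodule ℂ (MvPolynomial (Fin (h + h)) ℂ) :=
  Submodule.span ℂ ({1} ∪ Set.range (fun v => rho1 (desA w α β) (desB w) Finset.univ v) ∪
    Set.range (fun p : {p : Fin h × Fin h // p.1 ≠ p.2} => rho2 (desA w α β) (desB w) Finset.univ p.1.1 p.1.2))

/-- `1` is a row. -/
theorem one_mem_rowSpan : (1 : MvPolynomial (Fin (h + h)) ℂ) ∈ rowSpan w α β :=
  Submodule.subset_span (Or.inl (Or.inl rfl))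

/-- `ρ̂₁ v` is a row. -/
theorem rho1_mem_rowSpan (v : Fin h) : rho1 (desA w α β) (desB w) Finset.univ v ∈ rowSpan w α β :=
  Submodule.subset_span (Or.inl (Or.inr ⟨v, rfl⟩))

/-- `ρ̂₂ a b` is a row (`a ≠ b`). -/
theorem rho2_mem_rowSpan (a b : Fin h) (hab : a ≠ b) : rho2 (desA w α β) (desB w) Finset.univ a b ∈ rowSpan w α β :=
  Submodule.subset_span (Or.inr ⟨⟨(a, b), hab⟩, rfl⟩)

/-- `C c = c • 1` lies in the row span. -/
theorem C_mem_rowSpan (c : ℂ) : (C c : MvPolynomial (Fin (h + h)) ℂ) ∈ rowSpan w α β := by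
  rw [← mul_one (C c), ← smul_eq_C_mul]
  exact Submodule.smul_mem _ c (one_mem_rowSpan w α β)

/-- `rr v = ρ̂₁ v − C(1 + inc v ∅)` lies in the row span. -/
theorem rr_mem_rowSpan (v : Fin h) : rr w α β v ∈ rowSpan w α β :=
  Submodule.sub_mem _ (rho1_mem_rowSpan w α β v) (C_mem_rowSpan w α β _)

/-- `rr a · rr b = ρ̂₂ a b + corr(a,b) − c_a ρ̂₁ b − c_b ρ̂₁ a + c_a c_b` with `corr = Σ_{j : e_j = {a,b}} t_j²`. -/
theorem rr_mul_rr_eq (a b : Fin h) (hab : a ≠ b) :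
    rr w α β a * rr w α β b = rho2 (desA w α β) (desB w) Finset.univ a b +
      ∑ j ∈ Finset.univ.filter (fun j : {j : Fin r // (w j).card = 3} =>
          (a = α j ∨ a = β j) ∧ (b = α j ∨ b = β j)), tinv (desB w) (Sum.inr j) * tinv (desB w) (Sum.inr j) -
      C (1 + (inc w α β a ∅ : ℂ)) * rho1 (desA w α β) (desB w) Finset.univ b -
      C (1 + (inc w α β b ∅ : ℂ)) * rho1 (desA w α β) (desB w) Finset.univ a +
      C (1 + (inc w α β a ∅ : ℂ)) * C (1 + (inc w α β b ∅ : ℂ)) := by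
  unfold rr
  rw [rho2_eq, corr_des w α β a b hab]
  ring

/-- For a pair that is not matched (`∀ j, {α j, β j} ≠ {a,b}`), the correction sum is empty. -/
theorem corr_eq_zero_of_unmatched (a b : Fin h) (hab : a ≠ b)
    (hun : ∀ j : {j : Fin r // (w j).card = 3}, ({α j, β j} : Finset (Fin h)) ≠ {a, b}) :
    ∑ j ∈ Finset.univ.filter (fun j : {j : Fin r // (w j).card = 3} =>
        (a = α j ∨ a = β j) ∧ (b = α j ∨ b = β j)), tinv (desB w) (Sum.inr j) * tinv (desB w) (Sum.inr j) = 0 := by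
  refine Finset.sum_eq_zero fun j hj => ?_
  exfalso
  obtain ⟨ha, hb⟩ := (Finset.mem_filter.mp hj).2
  apply hun j
  rcases ha with rfl | rfl <;> rcases hb with h1 | h1
  · exact absurd h1.symm hab
  · rw [← h1]
  · rw [← h1, Finset.pair_comm]
  · exact absurd h1.symm hab

/-- **Edge rows**: `rr a · rr b` lies in the row span when `{a,b}` is unmatched. -/
theorem rr_mul_rr_mem_rowSpan (a b : Fin h) (hab : a ≠ b)
    (hun : ∀ j : {j : Fin r // (w j).card = 3}, ({α j, β j} : Finset (Fin h)) ≠ {a, b}) :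
    rr w α β a * rr w α β b ∈ rowSpan w α β := by
  rw [rr_mul_rr_eq w α β a b hab, corr_eq_zero_of_unmatched w α β a b hab hun, add_zero]
  refine Submodule.add_mem _ (Submodule.sub_mem _ (Submodule.sub_mem _ (rho2_mem_rowSpan w α β a b hab) ?_) ?_) ?_
  · rw [← smul_eq_C_mul]; exact Submodule.smul_mem _ _ (rho1_mem_rowSpan w α β b)
  · rw [← smul_eq_C_mul]; exact Submodule.smul_mem _ _ (rho1_mem_rowSpan w α β a)
  · rw [← C_mul]; exact C_mem_rowSpan w α β _

include hα hβ hK in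
/-- **Non-edge rows**: `rr (α j) · rr (β j) + corrNE j` lies in the row span (the `t_j²` terms cancel:
`t_j² − (2 qq j + qq j²) = 1`). Needs the matching to be injective and `α j ≠ β j`. -/
theorem pNE_mem_rowSpan (hαβ : ∀ j, α j ≠ β j)
    (hinjE : ∀ j j' : {j : Fin r // (w j).card = 3}, ({α j, β j} : Finset (Fin h)) = {α j', β j'} → j = j')
    (j : {j : Fin r // (w j).card = 3}) :
    rr w α β (α j) * rr w α β (β j) + corrNE w α β j ∈ rowSpan w α β := by
  classical
  -- the correction filter is `{j}`
  have hfilt : Finset.univ.filter (fun j' : {j : Fin r // (w j).card = 3} =>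
      (α j = α j' ∨ α j = β j') ∧ (β j = α j' ∨ β j = β j')) = {j} := by
    ext j'
    rw [Finset.mem_filter, Finset.mem_singleton]
    constructor
    · rintro ⟨-, ha, hb⟩
      symm
      apply hinjE j j'
      rcases ha with ha | ha <;> rcases hb with hb | hb
      · exact absurd (ha.trans hb.symm) (hαβ j)
      · rw [ha, hb]
      · rw [ha, hb, Finset.pair_comm]
      · exact absurd (ha.trans hb.symm) (hαβ j)
    · rintro rfl
      exact ⟨Finset.mem_univ _, Or.inl rfl, Or.inr rfl⟩
  have hsq : tinv (desB w) (Sum.inr j) * tinv (desB w) (Sum.inr j) - (2 * qq w j + qq w j * qq w j) = 1 := by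
    unfold qq; ring
  have hexp : rr w α β (α j) * rr w α β (β j) + corrNE w α β j =
      rho2 (desA w α β) (desB w) Finset.univ (α j) (β j) -
        C (1 + (inc w α β (α j) ∅ : ℂ)) * rho1 (desA w α β) (desB w) Finset.univ (β j) -
        C (1 + (inc w α β (β j) ∅ : ℂ)) * rho1 (desA w α β) (desB w) Finset.univ (α j) +
        (C (1 + (inc w α β (α j) ∅ : ℂ)) * C (1 + (inc w α β (β j) ∅ : ℂ)) + 1) -
        ∑ t, C (inc w α β (β j) {t} : ℂ) * (rr w α β t * rr w α β (α j)) -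
        ∑ t, C (inc w α β (α j) {t} : ℂ) * (rr w α β t * rr w α β (β j)) := by
    unfold corrNE
    rw [rr_mul_rr_eq w α β (α j) (β j) (hαβ j), hfilt, Finset.sum_singleton]
    linear_combination hsq
  rw [hexp]
  have hsum : ∀ (a b : Fin h), a ∈ O →
      ∑ t, C (inc w α β b {t} : ℂ) * (rr w α β t * rr w α β a) ∈ rowSpan w α β := by
    intro a b ha
    refine Submodule.sum_mem _ fun t _ => ?_
    by_cases hz : inc w α β b {t} = 0
    · rw [hz]; simp
    · have ht : t ∉ O := not_mem_of_inc_single_ne_zero w O α β hK hz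
      have hta : t ≠ a := fun e => ht (e ▸ ha)
      rw [← smul_eq_C_mul]
      refine Submodule.smul_mem _ _ (rr_mul_rr_mem_rowSpan w α β t a hta fun j' e => ht ?_)
      have : t ∈ ({α j', β j'} : Finset (Fin h)) := by rw [e]; simp
      rcases Finset.mem_insert.mp this with h1 | h1
      · rw [h1]; exact hα j'
      · rw [Finset.mem_singleton.mp h1]; exact hβ j'
  refine Submodule.sub_mem _ (Submodule.sub_mem _ (Submodule.add_mem _ (Submodule.sub_mem _ (Submodule.sub_mem _
    (rho2_mem_rowSpan w α β _ _ (hαβ j)) ?_) ?_) ?_) (hsum _ _ (hα j))) (hsum _ _ (hβ j))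
  · rw [← smul_eq_C_mul]; exact Submodule.smul_mem _ _ (rho1_mem_rowSpan w α β _)
  · rw [← smul_eq_C_mul]; exact Submodule.smul_mem _ _ (rho1_mem_rowSpan w α β _)
  · rw [← C_mul, ← C_1, ← C_add]; exact C_mem_rowSpan w α β _

end Span

end

end Summit.ValiantsHypothesis.ValiantsHypothesis.Theorems.BarrierLever.ChowStarvedDesign
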